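/-
VALUE = THEOREM (the stabiliser of an isotropic vector in the reflection class group), NOT summit
progress (cell b2b-lgcu-borel, gen 24); the crux item stmt-MatrixMultiplication-14079 is untouched.
-/
import Mathlib
import Literature.NumberTheory.EllipticCurves.BinaryQuarticDiscriminantFpCountProofs
import Summits.MatrixMultiplication.MatrixMultiplication.Theorems.SubgroupIdentityDesigns.Negative.ReflectionClassIsoLines
import Summits.MatrixMultiplication.MatrixMultiplication.Theorems.SubgroupIdentityDesigns.Negative.ReflectionClassStabClass
import Summits.MatrixMultiplication.MatrixMultiplication.Theorems.SubgroupIdentityDesigns.Negative.ReflectionClassStabIso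

/-!
# Siegel transformations lie in the class group; the stabiliser of an isotropic vector

VALUE = THEOREM (generic in the prime `p ≥ 5`), NOT summit progress; the crux item
stmt-MatrixMultiplication-14079 is untouched and remains open.

Layer F4c-3 of the all-`p` proof of the unified reflection-class certificate (ORACLE-g24 §G24-1 (L1),
§G24-3).  `K = classGroup p σ`; `x ≠ 0` isotropic, `y ⊥ x` anisotropic.

* `refl_mul_refl_mem_of_cross` — `R_z R_{z₀} ∈ K` for anisotropic `z, z₀` of the same class
  spanning a NON-DEGENERATE plane (`Q(z × z₀) ≠ 0`), whatever `σ` (from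
  `ReflectionClassStabClass.refl_mul_refl_mem`);
* `siegelGL_mem` — **every Siegel transformation `E_β` lies in `K`** (`p ≥ 5`): although the two
  mirrors `y`, `y + λx` of `E_β = R_y R_{y+λx}` span a degenerate plane, inserting an auxiliary
  `w = y + λ x + ν x'` (`x'` a hyperbolic partner, `2λν = 3 Q(y)`, so `Q(w) = 4 Q(y)`) gives
  `E_β = (R_y R_w)(R_w R_{y+λx})` with both planes non-degenerate;
* `stab_iso_iff` — for `−c` a non-square and `σ = [c is a square]`:
  **`s ∈ K ∧ s x = x ⟺ s = E_β` for some `β`** (unique by `ReflectionClassSiegel.siegelGL_inj`).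
  The improper candidates `E_β R_y` are excluded by the sign character `ι`
  (`ReflectionClassIsoSign`): `ι(E_β R_y) = χ(Q y) = χ(−1) ≠ χ(c) = ι|_{K, det = −1}`.
HONEST SCOPE.  Group theory only; by itself it excludes nothing.
-/

set_option linter.dupNamespace false

open scoped BigOperators Matrix

namespace Summit.MatrixMultiplication.MatrixMultiplication.Theorems.SubgroupIdentityDesigns.Negative
namespace ReflectionClassSiegelClass

open Summit.MatrixMultiplication.MatrixMultiplication.Theorems.LieRankDesigns.Negative (GLm Mat)
open ReflectionClassCertificate (V classGroup)
open NonsquareReflections (reflMat refl coe_refl reflMat_mul_self det_reflMat)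
open ReflectionClassPlane (w₁ w₁_dot_x w₁_dot_ω w₁_dot_self)
open ReflectionClassIsoLines (exists_frame)
open ReflectionClassIsoSign (O3 mem_O3 refl_mem_O3 iota reflO iota_reflO eps iota_of_mem_classGroup)
open ReflectionClassStabClass (refl_mul_refl_mem qchar_eq_eps qchar_eq_iff)
open ReflectionClassSiegel (siegelGL coe_siegelGL siegelGL_mulVec_x det_siegelGL siegelGL_zero
  not_class_of_perp_isotropic dot_self_add_smul)
open ReflectionClassStabIso (exists_partner stab_proper_GL stab_improper)
open Literature.NumberTheory.EllipticCurves.BinaryQuartic (two_ne_zero_zmod three_ne_zero_zmod)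
open DihedralUnipotent (neg_one_ne_one)

variable {p : ℕ} [hp : Fact p.Prime]

section K

variable {σ : Bool}

/-- `R_z R_{z₀} ∈ K` for anisotropic `z, z₀` of the same class with `Q(z × z₀) ≠ 0`. -/
theorem refl_mul_refl_mem_of_cross (hp2 : p ≠ 2) {z z₀ : V p} (hz : z ⬝ᵥ z ≠ 0)
    (hz₀ : z₀ ⬝ᵥ z₀ ≠ 0) (hn : w₁ z z₀ ⬝ᵥ w₁ z z₀ ≠ 0)
    (hcl : IsSquare (z ⬝ᵥ z) ↔ IsSquare (z₀ ⬝ᵥ z₀)) : refl z * refl z₀ ∈ classGroup p σ := by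
  obtain ⟨ω, hQ⟩ := exists_frame hp2 hn
  have hzx : z ⬝ᵥ w₁ z z₀ = 0 := by rw [dotProduct_comm]; exact w₁_dot_x z z₀
  have hz₀x : z₀ ⬝ᵥ w₁ z z₀ = 0 := by rw [dotProduct_comm]; exact w₁_dot_ω z z₀
  exact refl_mul_refl_mem hp2 hn hQ hzx hz hz₀x hz₀ hcl

/-- `Q(a)` and `4 Q(a)` have the same class. -/
theorem isSquare_iff_four_mul (hp2 : p ≠ 2) (a : ZMod p) : IsSquare a ↔ IsSquare (4 * a) := by
  have h2 : (2 : ZMod p) ≠ 0 := two_ne_zero_zmod hp2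
  constructor
  · rintro ⟨r, hr⟩; exact ⟨2 * r, by rw [hr]; ring⟩
  · rintro ⟨r, hr⟩
    refine ⟨r / 2, ?_⟩
    field_simp
    linear_combination hr

variable {x y : V p}

/-- **Siegel transformations lie in the class group** (`p ≥ 5`, any class `σ`). -/
theorem siegelGL_mem (hp5 : 5 ≤ p) (hx0 : x ≠ 0) (hxx : x ⬝ᵥ x = 0) (hyx : y ⬝ᵥ x = 0)
    (hy : y ⬝ᵥ y ≠ 0) (β : ZMod p) : siegelGL x y β ∈ classGroup p σ := by
  have hp2 : p ≠ 2 := by omega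
  have h2 : (2 : ZMod p) ≠ 0 := two_ne_zero_zmod hp2
  have h3 : (3 : ZMod p) ≠ 0 := three_ne_zero_zmod (by omega)
  have h4 : (4 : ZMod p) ≠ 0 := by
    rw [show (4 : ZMod p) = 2 * 2 by norm_num]; exact mul_ne_zero h2 h2
  have hxy : x ⬝ᵥ y = 0 := by rw [dotProduct_comm]; exact hyx
  by_cases hβ : β = 0
  · rw [hβ, siegelGL_zero hp2 hxx hyx hy]; exact one_mem _
  -- `λ = β Q(y) / 2 ≠ 0`, the second mirror is `y + λ x`
  obtain ⟨l, hldef⟩ : ∃ l : ZMod p, l = β * (y ⬝ᵥ y) / 2 := ⟨_, rfl⟩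
  have hl : l ≠ 0 := by rw [hldef]; exact div_ne_zero (mul_ne_zero hβ hy) h2
  obtain ⟨x', hx'x, hx'y, hx'x'⟩ := exists_partner hp2 hx0 hxx hyx hy
  have hxx' : x ⬝ᵥ x' = 1 := by rw [dotProduct_comm]; exact hx'x
  have hyx' : y ⬝ᵥ x' = 0 := by rw [dotProduct_comm]; exact hx'y
  -- the auxiliary mirror `w = y + λ x + ν x'`, `2 λ ν = 3 Q(y)`
  obtain ⟨ν, hνdef⟩ : ∃ ν : ZMod p, ν = 3 * (y ⬝ᵥ y) / (2 * l) := ⟨_, rfl⟩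
  have hν : ν ≠ 0 := by
    rw [hνdef]; exact div_ne_zero (mul_ne_zero h3 hy) (mul_ne_zero h2 hl)
  have hlν : 2 * (l * ν) = 3 * (y ⬝ᵥ y) := by rw [hνdef]; field_simp
  obtain ⟨w, hwdef⟩ : ∃ w : V p, w = y + l • x + ν • x' := ⟨_, rfl⟩
  have hww : w ⬝ᵥ w = 4 * (y ⬝ᵥ y) := by
    rw [hwdef]
    simp only [add_dotProduct, dotProduct_add, smul_dotProduct, dotProduct_smul, smul_eq_mul, hxx,
      hyx, hxy, hx'x, hxx', hx'y, hyx', hx'x', mul_zero, mul_one, add_zero, zero_add]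
    linear_combination hlν
  have hyw : y ⬝ᵥ w = y ⬝ᵥ y := by
    rw [hwdef, dotProduct_add, dotProduct_add, dotProduct_smul, dotProduct_smul, smul_eq_mul,
      smul_eq_mul, hyx, hyx', mul_zero, mul_zero, add_zero, add_zero]
  have hbb : (y + l • x) ⬝ᵥ (y + l • x) = y ⬝ᵥ y := dot_self_add_smul hxx hyx l
  have hwb : w ⬝ᵥ (y + l • x) = y ⬝ᵥ y + l * ν := by
    rw [hwdef]
    simp only [add_dotProduct, dotProduct_add, smul_dotProduct, dotProduct_smul, smul_eq_mul, hxx,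
      hxy, hx'x, hx'y, hyx, mul_zero, mul_one, add_zero]
    ring
  have hw0 : w ⬝ᵥ w ≠ 0 := by rw [hww]; exact mul_ne_zero h4 hy
  have hb0 : (y + l • x) ⬝ᵥ (y + l • x) ≠ 0 := by rw [hbb]; exact hy
  -- both planes are non-degenerate
  have hn₁ : w₁ y w ⬝ᵥ w₁ y w ≠ 0 := by
    rw [w₁_dot_self, hww, hyw, show y ⬝ᵥ y * (4 * (y ⬝ᵥ y)) - (y ⬝ᵥ y) ^ 2 =
      3 * ((y ⬝ᵥ y) * (y ⬝ᵥ y)) by ring]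
    exact mul_ne_zero h3 (mul_ne_zero hy hy)
  have hn₂ : w₁ w (y + l • x) ⬝ᵥ w₁ w (y + l • x) ≠ 0 := by
    have hval : w₁ w (y + l • x) ⬝ᵥ w₁ w (y + l • x) = -(l * ν) ^ 2 := by
      rw [w₁_dot_self, hww, hbb, hwb]
      linear_combination (-(y ⬝ᵥ y)) * hlν
    rw [hval, neg_ne_zero]
    exact pow_ne_zero 2 (mul_ne_zero hl hν)
  -- classes: `Q(w) = 4 Q(y)`, `Q(y + λx) = Q(y)`
  have hcl₁ : IsSquare (y ⬝ᵥ y) ↔ IsSquare (w ⬝ᵥ w) := by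
    rw [hww]; exact isSquare_iff_four_mul hp2 _
  have hcl₂ : IsSquare (w ⬝ᵥ w) ↔ IsSquare ((y + l • x) ⬝ᵥ (y + l • x)) := by
    rw [hbb]; exact hcl₁.symm
  have h₁ : refl y * refl w ∈ classGroup p σ := refl_mul_refl_mem_of_cross hp2 hy hw0 hn₁ hcl₁
  have h₂ : refl w * refl (y + l • x) ∈ classGroup p σ :=
    refl_mul_refl_mem_of_cross hp2 hw0 hb0 hn₂ hcl₂
  have hww1 : refl w * refl w = (1 : GLm p 3) :=
    Units.ext (by rw [Units.val_mul, coe_refl, reflMat_mul_self, Units.val_one])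
  have hprod := mul_mem h₁ h₂
  rw [mul_assoc, ← mul_assoc (refl w), hww1, one_mul] at hprod
  rw [siegelGL, ← hldef]
  exact hprod

/-- Siegel transformations are isometries. -/
theorem siegelGL_mem_O3 (x y : V p) (β : ZMod p) : siegelGL x y β ∈ O3 p :=
  mul_mem (refl_mem_O3 _) (refl_mem_O3 _)

/-- `ι(E_β) = 1` (`p ≥ 5`): `E_β ∈ K` with `det E_β = 1`. -/
theorem iota_siegelGL (hp5 : 5 ≤ p) (hx0 : x ≠ 0) (hxx : x ⬝ᵥ x = 0) (hyx : y ⬝ᵥ x = 0)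
    (hy : y ⬝ᵥ y ≠ 0) (β : ZMod p) :
    ((iota ⟨siegelGL x y β, siegelGL_mem_O3 x y β⟩ : ℤˣ) : ℤ) = 1 := by
  have hp2 : p ≠ 2 := by omega
  obtain ⟨hO, h⟩ := iota_of_mem_classGroup hp2 true (siegelGL_mem hp5 hx0 hxx hyx hy β)
  rcases h with ⟨-, h1⟩ | ⟨hd, -⟩
  · rw [h1, Units.val_one]
  · exfalso
    rw [det_siegelGL hxx hyx hy] at hd
    exact neg_one_ne_one hp2 hd.symm

end K

/-! ## The stabiliser of an isotropic vector in `K` -/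

section Stab

variable {c : ZMod p} {x y : V p}

/-- **Stabiliser of an isotropic vector.**  For `p ≥ 5`, `−c` a non-square, `σ = [c is a square]`,
`x ≠ 0` isotropic and `y ⊥ x` anisotropic:  `s ∈ K ∧ s x = x ⟺ ∃ β, s = E_β`. -/
theorem stab_iso_iff (hp5 : 5 ≤ p) (hc : ¬ IsSquare (-c)) (hx0 : x ≠ 0) (hxx : x ⬝ᵥ x = 0)
    (hyx : y ⬝ᵥ x = 0) (hy : y ⬝ᵥ y ≠ 0) (s : GLm p 3) :
    (s ∈ classGroup p (decide (IsSquare c)) ∧ (s : Mat p 3) *ᵥ x = x) ↔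
      ∃ β : ZMod p, s = siegelGL x y β := by
  have hp2 : p ≠ 2 := by omega
  have hc0 : c ≠ 0 := by rintro rfl; exact hc (by rw [neg_zero]; exact IsSquare.zero)
  constructor
  · rintro ⟨hs, hsx⟩
    obtain ⟨hO, h⟩ := iota_of_mem_classGroup hp2 _ hs
    have hg : ((s : Mat p 3))ᵀ * (s : Mat p 3) = 1 := mem_O3.mp hO
    rcases h with ⟨hdet, -⟩ | ⟨hdet, hι⟩
    · exact stab_proper_GL hp2 hx0 hxx hyx hy hg hsx hdet
    · exfalso
      obtain ⟨β, hβ⟩ := stab_improper hp2 hx0 hxx hyx hy hg hsx hdet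
      have hs' : s = siegelGL x y β * refl y :=
        Units.ext (by rw [Units.val_mul, coe_siegelGL hp2 hxx hyx hy, coe_refl, hβ])
      have hprod : (⟨s, hO⟩ : O3 p) = ⟨siegelGL x y β, siegelGL_mem_O3 x y β⟩ * reflO y :=
        Subtype.ext hs'
      have hιs : ((iota ⟨s, hO⟩ : ℤˣ) : ℤ) = quadraticChar (ZMod p) (y ⬝ᵥ y) := by
        rw [hprod, map_mul, Units.val_mul, iota_siegelGL hp5 hx0 hxx hyx hy, one_mul,
          iota_reflO hp2 hy]
      rw [hι, ← qchar_eq_eps hc0, eq_comm, qchar_eq_iff hy hc0] at hιs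
      exact not_class_of_perp_isotropic hc hx0 hxx hyx hy hιs
  · rintro ⟨β, rfl⟩
    exact ⟨siegelGL_mem hp5 hx0 hxx hyx hy β, siegelGL_mulVec_x hp2 hxx hyx hy β⟩

/-- No improper element of `K` fixes an isotropic vector. -/
theorem det_of_mem_stab_iso (hp5 : 5 ≤ p) (hc : ¬ IsSquare (-c)) (hx0 : x ≠ 0)
    (hxx : x ⬝ᵥ x = 0) (hyx : y ⬝ᵥ x = 0) (hy : y ⬝ᵥ y ≠ 0) {s : GLm p 3}
    (hs : s ∈ classGroup p (decide (IsSquare c))) (hsx : (s : Mat p 3) *ᵥ x = x) :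
    (s : Mat p 3).det = 1 := by
  have hp2 : p ≠ 2 := by omega
  obtain ⟨β, rfl⟩ := (stab_iso_iff hp5 hc hx0 hxx hyx hy s).mp ⟨hs, hsx⟩
  exact det_siegelGL hxx hyx hy β

end Stab

end ReflectionClassSiegelClass
end Summit.MatrixMultiplication.MatrixMultiplication.Theorems.SubgroupIdentityDesigns.Negative
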